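import Literature.NumberTheory.Sieve.LargeGapsRankinViaMcCurley
import HarnessLib

/-!
# Large gaps between primes: the covering-to-gap transfers `Y ⇒ G` (Ford–Green–Konyagin–Tao's
# "Theorem 1 follows from Theorem 2"; Ford–Green–Konyagin–Maynard–Tao's (1.2) ⇒ Theorem 1)

Topic `Literature/NumberTheory/Sieve`. Everything in this file is PROVED.

`LargeGapsBetweenPrimes.lean` types the covering theorems (`FordGreenKonyaginTao2016_theorem2`:
`Y(x) ≥ R x log x log₃ x/(log₂ x)²` for every `R`; `FordGreenKonyaginMaynardTao2018_coveringBound`: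
`Y(x) ≫ x log x log₃ x/log₂ x`) and the gap theorems (`FordGreenKonyaginTao2016_theorem1`,
`FordGreenKonyaginMaynardTao2018_theorem1`) as separate named facts and deliberately left the printed
deduction "By the prime number theorem we have `P(x) = e^{(1+o(1))x}` … Thus the bound of Lemma 1.1
implies that `G(X) ≥ Y((1+o(1)) log X)` as `X → ∞`. Theorem 1 follows from this and [Theorem 2]"
unformalised. This file PROVES those deductions (with `x = ⌊log X/3⌋`, `P(x) ≤ 4ˣ ≤ √X` in place of
the prime number theorem, at the cost of the constant `1/64`, immaterial for both theorems):

* `eventually_log_le_rankinRate`, `tendsto_rankinRate_atTop`: `rankinRate X ≥ log X → ∞`;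
* `fgkt2016_theorem1_of_theorem2`: **FGKT 2016, Theorem 2 ⇒ Theorem 1** (via the Rankin-rate
  transfer `RankinTransfer.eventually_hasPrimeGap_of_cover` of `LargeGapsRankinViaMcCurley.lean` and
  `hasCompositeRun_of_hasPrimeGap`), and `rankinConstant_of_fgkt2016_theorem2`: Theorem 2 ⇒
  `RankinConstant c` for every `c` (hence Pintz, Rankin, Erdős, Westzynthius down the chain);
* `FGKMTTransfer.eventually_hasPrimeGap_of_cover`: the transfer at the FGKMT rate — a covering
  `Y(w) ≥ ⌊α · w log w log₃ w/log₂ w⌋` for all large `w` gives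
  `G(X) ≥ (α/64) log X log₂ X log₄ X/log₃ X` for all large `X`;
* `fgkmt2018_theorem1_of_coveringBound`: **FGKMT 2018, (1.2) ⇒ Theorem 1**, and
  `rankinConstant_of_fgkmt2018_coveringBound`.

So of the ladder's eleven named facts, the two covering bounds now carry the two record gap theorems.

## References

* K. Ford, B. Green, S. Konyagin, T. Tao, *Large gaps between consecutive prime numbers*, Ann. of
  Math. 183 (2016) 935–974: Lemma 1.1, (1.1) = Theorem 2, and p. 937 ("Theorem 1 follows from this").
  [FordGreenKonyaginTao2016]
* K. Ford, B. Green, S. Konyagin, J. Maynard, T. Tao, *Long gaps between primes*, J. Amer. Math.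
  Soc. 31 (2018) 65–105: Theorem 1, Lemma 1.1, (1.2). [FordGreenKonyaginMaynardTao2018]
-/

open Filter Finset

namespace Literature.NumberTheory.Sieve

/-! ### Growth of Rankin's rate -/

/-- `rankinRate X ≥ log X` for all large `X` (`log₂ X · log₄ X ≥ (log₃ X)²` eventually, indeed
`(log₃ X)² ≤ log₂ X` and `log₄ X ≥ 1`). [cite: FordGreenKonyaginTao2016, (1.1) and p. 937] -/
theorem eventually_log_le_rankinRate : ∀ᶠ X : ℝ in atTop, Real.log X ≤ rankinRate X := by
  have hT₂ : Tendsto (fun X : ℝ => Real.log (Real.log X)) atTop atTop :=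
    Real.tendsto_log_atTop.comp Real.tendsto_log_atTop
  have hT₄ : Tendsto (fun X : ℝ => Real.log (Real.log (Real.log (Real.log X)))) atTop atTop :=
    Real.tendsto_log_atTop.comp (Real.tendsto_log_atTop.comp hT₂)
  have ho := (Real.isLittleO_pow_log_id_atTop (n := 2)).bound (show (0 : ℝ) < 1 by norm_num)
  filter_upwards [hT₂.eventually ho, hT₂.eventually_ge_atTop 3, hT₄.eventually_ge_atTop 1,
    Real.tendsto_log_atTop.eventually_ge_atTop 0] with X hoT hT3 hr1 hlog0
  have ht0 : 0 < Real.log (Real.log X) := by linarith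
  rw [Real.norm_eq_abs, Real.norm_eq_abs, id, abs_of_nonneg (by positivity),
    abs_of_nonneg ht0.le] at hoT
  have i2 : Real.log^[2] X = Real.log (Real.log X) := by simp [Function.iterate_succ_apply']
  have i3 : Real.log^[3] X = Real.log (Real.log (Real.log X)) := by
    simp [Function.iterate_succ_apply']
  have i4 : Real.log^[4] X = Real.log (Real.log (Real.log (Real.log X))) := by
    simp [Function.iterate_succ_apply']
  rw [rankinRate, i2, i3, i4]
  have hs0 : 0 < Real.log (Real.log (Real.log X)) := by
    have h3 : Real.log 3 ≤ Real.log (Real.log (Real.log X)) := Real.log_le_log (by norm_num) hT3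
    have : 1 < Real.log 3 := by
      rw [← Real.exp_lt_exp, Real.exp_log (by norm_num)]
      have := Real.exp_one_lt_d9; linarith
    linarith
  rw [le_div_iff₀ (by positivity)]
  have h1 : Real.log X * Real.log (Real.log (Real.log X)) ^ 2 ≤ Real.log X * Real.log (Real.log X) :=
    mul_le_mul_of_nonneg_left (by linarith) hlog0
  have h2 : Real.log X * Real.log (Real.log X) ≤
      Real.log X * Real.log (Real.log X) * Real.log (Real.log (Real.log (Real.log X))) :=
    le_mul_of_one_le_right (by positivity) hr1
  linarith

/-- `rankinRate X → ∞`. [cite: FordGreenKonyaginTao2016, (1.1) and p. 937] -/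
theorem tendsto_rankinRate_atTop : Tendsto rankinRate atTop atTop :=
  tendsto_atTop_mono' atTop eventually_log_le_rankinRate Real.tendsto_log_atTop

/-! ### Ford–Green–Konyagin–Tao 2016: Theorem 2 ⇒ Theorem 1 -/

/-- Unfolding of the printed covering rate (`log_k` as iterates) into nested logarithms.
[folklore] -/
private theorem iterate_log_three (w : ℝ) :
    Real.log^[3] w = Real.log (Real.log (Real.log w)) := by
  simp [Function.iterate_succ_apply']

/-- Unfolding of `log₂` as an iterate. [folklore] -/
private theorem iterate_log_two (w : ℝ) : Real.log^[2] w = Real.log (Real.log w) := by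
  simp [Function.iterate_succ_apply']

/-- From FGKT's Theorem 2 (every `R`): for every `α > 0` and all large `w`,
`Y(w) ≥ ⌊α · w log w log₃ w/(log₂ w)²⌋`. [cite: FordGreenKonyaginTao2016, Theorem 2 = (1.1)] -/
theorem FordGreenKonyaginTao2016_theorem2.eventually_cover (h : FordGreenKonyaginTao2016_theorem2)
    (α : ℝ) :
    ∀ᶠ w : ℕ in atTop, ResidueClassesCover w
      ⌊α * ((w : ℝ) * Real.log w * Real.log (Real.log (Real.log w)) /
        (Real.log (Real.log w)) ^ 2)⌋₊ := by
  filter_upwards [h α] with w hw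
  obtain ⟨y, hy, hcov⟩ := hw
  rw [iterate_log_three, iterate_log_two] at hy
  exact hcov.mono le_rfl ((Nat.floor_le_floor hy).trans (Nat.floor_natCast y).le)

/-- **Ford–Green–Konyagin–Tao 2016: Theorem 2 ⇒ Theorem 1** ("Thus the bound of Lemma 1.1 implies
that `G(X) ≥ Y((1+o(1)) log X)` as `X → ∞`. Theorem 1 follows from this and [Theorem 2]"): for every
`R`, all large `X` admit at least `R log X log₂ X log₄ X/(log₃ X)²` consecutive composite numbers
`≤ X`. PROVED (transfer at `x = ⌊log X/3⌋` with `P(x) ≤ 4ˣ`; the lost constant is absorbed by the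
arbitrary `R` of Theorem 2). [cite: FordGreenKonyaginTao2016, p. 937 and Lemma 1.1] -/
theorem fgkt2016_theorem1_of_theorem2 (h : FordGreenKonyaginTao2016_theorem2) :
    FordGreenKonyaginTao2016_theorem1 := by
  intro R
  have hα0 : (0 : ℝ) < 64 * (max R 0 + 2) := by positivity
  have hgap := RankinTransfer.eventually_hasPrimeGap_of_cover hα0 (h.eventually_cover _)
  filter_upwards [hgap, eventually_log_le_rankinRate,
    Real.tendsto_log_atTop.eventually_ge_atTop 1] with X hX hlr hlog1
  refine ⟨⌈64 * (max R 0 + 2) / 64 * rankinRate X⌉₊ - 1, ?_, hasCompositeRun_of_hasPrimeGap hX⟩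
  have hrr : 1 ≤ rankinRate X := hlog1.trans hlr
  have h64 : 64 * (max R 0 + 2) / 64 * rankinRate X = (max R 0 + 2) * rankinRate X := by ring
  rw [h64]
  have hR0 : 0 ≤ max R 0 := le_max_right _ _
  have hv2 : 2 ≤ (max R 0 + 2) * rankinRate X := by nlinarith
  have hceil1 : 1 ≤ ⌈(max R 0 + 2) * rankinRate X⌉₊ := Nat.one_le_ceil_iff.2 (by linarith)
  rw [Nat.cast_sub hceil1, Nat.cast_one]
  have hceil := Nat.le_ceil ((max R 0 + 2) * rankinRate X)
  calc R * rankinRate X ≤ max R 0 * rankinRate X :=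
        mul_le_mul_of_nonneg_right (le_max_left _ _) (by linarith)
    _ = (max R 0 + 2) * rankinRate X - 2 * rankinRate X := by ring
    _ ≤ (⌈(max R 0 + 2) * rankinRate X⌉₊ : ℝ) - 1 := by linarith

/-- **FGKT Theorem 2 ⇒ every Rankin constant** (`G(X) ≥ (c − ε) rankinRate X` for all large `X`,
every `c`), hence Pintz's, Rankin's, Erdős's and Westzynthius's theorems down the chain of
`LargeGapsBetweenPrimes.lean`. [cite: FordGreenKonyaginTao2016, Theorems 1–2 and p. 936] -/
theorem rankinConstant_of_fgkt2016_theorem2 (h : FordGreenKonyaginTao2016_theorem2) (c : ℝ) :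
    RankinConstant c := by
  intro ε hε
  have hα0 : (0 : ℝ) < 64 * (max c 0 + 1) := by positivity
  have hgap := RankinTransfer.eventually_hasPrimeGap_of_cover hα0 (h.eventually_cover _)
  filter_upwards [hgap, eventually_log_le_rankinRate, Real.tendsto_log_atTop.eventually_ge_atTop 0]
    with X hX hlr hlog0
  have hr0 : 0 ≤ rankinRate X := hlog0.trans hlr
  refine hX.mono le_rfl ?_
  have h64 : 64 * (max c 0 + 1) / 64 * rankinRate X = (max c 0 + 1) * rankinRate X := by ring
  rw [h64]
  have : c - ε ≤ max c 0 + 1 := by linarith [le_max_left c 0]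
  exact mul_le_mul_of_nonneg_right this hr0

/-- Consistency: FGKT Theorem 2 re-derives Pintz's `2e^γ` form and Westzynthius's theorem through
the chain. [folklore] -/
example (h : FordGreenKonyaginTao2016_theorem2) : Pintz1997_largeGaps :=
  pintz1997_of_rankinConstant (rankinConstant_of_fgkt2016_theorem2 h)

/-! ### The transfer at the Ford–Green–Konyagin–Maynard–Tao rate -/

namespace FGKMTTransfer

/-- The gap for one `X` at the FGKMT rate, all parameters explicit (`z = ⌊log X/3⌋`, `ℓ = log z`,
`ℓ₂ = log ℓ`, `ℓ₃ = log ℓ₂`, `t = log₂ X`, `s = log₃ X`, `r = log₄ X`, `U` the covered length).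
[folklore] -/
private theorem gap_of_params {α X ℓ ℓ₂ ℓ₃ t s r : ℝ} {z U : ℕ} (hα : 0 < α)
    (hz : z = ⌊Real.log X / 3⌋₊)
    (hℓ : ℓ = Real.log z) (hℓ₂ : ℓ₂ = Real.log ℓ) (hℓ₃ : ℓ₃ = Real.log ℓ₂)
    (ht : t = Real.log (Real.log X)) (hs : s = Real.log t) (hr : r = Real.log s)
    (hU : U = ⌊α * ((z : ℝ) * ℓ * ℓ₃ / ℓ₂)⌋₊)
    (hcovX : ResidueClassesCover z U) (hz3 : 3 ≤ z) (hlogXα : 64 / α ≤ Real.log X)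
    (hoX : α * Real.log X ^ 2 ≤ 1 / 8 * X) (hlinX : Real.log X ≤ 1 / 8 * X) (hT3 : 3 ≤ t)
    (hr2 : 2 ≤ r) (hX16 : 16 ≤ X) (hX12 : Real.exp 12 ≤ X) :
    HasPrimeGap X (α / 64 * fgkmtRate X) := by
  have hXpos : 0 < X := by linarith
  have hlogX12 : 12 ≤ Real.log X := by
    have := Real.log_le_log (Real.exp_pos 12) hX12
    rwa [Real.log_exp] at this
  have hlogXpos : 0 < Real.log X := by linarith
  have ht0 : 0 < t := by linarith
  have hsr : r ≤ s - 1 := by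
    have hs1 : 1 < s := by
      rw [hs, ← Real.exp_lt_exp, Real.exp_log ht0]
      have := Real.exp_one_lt_d9; linarith
    rw [hr]; exact Real.log_le_sub_one_of_pos (by linarith)
  have hs3 : 3 ≤ s := by linarith
  have hs0 : 0 < s := by linarith
  have hr0 : 0 < r := by linarith
  have hst : s ≤ t - 1 := by rw [hs]; exact Real.log_le_sub_one_of_pos ht0
  have hzr : (3 : ℝ) ≤ z := by exact_mod_cast hz3
  have hz0 : (0 : ℝ) < z := by linarith
  have hzle : (z : ℝ) ≤ Real.log X / 3 := by rw [hz]; exact Nat.floor_le (by positivity)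
  have hzge : Real.log X / 3 - 1 < z := by rw [hz]; exact Nat.sub_one_lt_floor _
  have hz4 : Real.log X / 4 ≤ z := by linarith
  have hlog4 : Real.log 4 ≤ 3 / 2 := by
    rw [show (4 : ℝ) = 2 ^ 2 by norm_num, Real.log_pow]
    have := Real.log_two_lt_d9; norm_num at this ⊢; linarith
  have hℓge : t / 2 ≤ ℓ := by
    have h1 : Real.log (Real.log X / 4) ≤ ℓ := by
      rw [hℓ]; exact Real.log_le_log (by positivity) hz4
    rw [Real.log_div hlogXpos.ne' (by norm_num), ← ht] at h1
    linarith
  have hℓle : ℓ ≤ t := by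
    rw [hℓ, ht]
    exact Real.log_le_log hz0 (by linarith)
  have hℓ0 : 0 < ℓ := by linarith
  have hℓ₂le : ℓ₂ ≤ s := by rw [hℓ₂, hs]; exact Real.log_le_log hℓ0 hℓle
  have hlog2 : Real.log 2 ≤ 1 := by
    have := Real.log_two_lt_d9; norm_num at this; linarith
  have hℓ₂ge : s / 2 ≤ ℓ₂ := by
    have h1 : Real.log (t / 2) ≤ ℓ₂ := by rw [hℓ₂]; exact Real.log_le_log (by positivity) hℓge
    rw [Real.log_div ht0.ne' (by norm_num), ← hs] at h1
    linarith
  have hℓ₂0 : 0 < ℓ₂ := by linarith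
  have hℓ₃ge : r / 2 ≤ ℓ₃ := by
    have h1 : Real.log (s / 2) ≤ ℓ₃ := by rw [hℓ₃]; exact Real.log_le_log (by positivity) hℓ₂ge
    rw [Real.log_div hs0.ne' (by norm_num), ← hr] at h1
    linarith
  have hℓ₃0 : 0 < ℓ₃ := by linarith
  have hℓ₃le : ℓ₃ ≤ ℓ₂ - 1 := by rw [hℓ₃]; exact Real.log_le_sub_one_of_pos hℓ₂0
  -- the covered length `U`
  have hV0 : 0 ≤ α * ((z : ℝ) * ℓ * ℓ₃ / ℓ₂) := by positivity
  have hUle : (U : ℝ) ≤ α * ((z : ℝ) * ℓ * ℓ₃ / ℓ₂) := by rw [hU]; exact Nat.floor_le hV0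
  have hUge : α * ((z : ℝ) * ℓ * ℓ₃ / ℓ₂) - 1 < U := by rw [hU]; exact Nat.sub_one_lt_floor _
  -- `R = log X · t · r/s` and `z ℓ ℓ₃/ℓ₂ ≥ R/16`
  have hR0 : 0 ≤ Real.log X * t * r / s := by positivity
  have hRle : Real.log X * t * r / s / 16 ≤ (z : ℝ) * ℓ * ℓ₃ / ℓ₂ := by
    rw [div_div, div_le_div_iff₀ (by positivity) (by positivity)]
    have h3 : Real.log X * t * r ≤ (4 * z) * (2 * ℓ) * (2 * ℓ₃) :=
      mul_le_mul (mul_le_mul (by linarith) (by linarith) ht0.le (by positivity)) (by linarith)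
        hr0.le (by positivity)
    calc Real.log X * t * r * ℓ₂ ≤ (4 * z) * (2 * ℓ) * (2 * ℓ₃) * s :=
          mul_le_mul h3 hℓ₂le hℓ₂0.le (by positivity)
      _ = (z : ℝ) * ℓ * ℓ₃ * (s * 16) := by ring
  -- `R ≥ 2 log X` (from `s ≤ t`, `r ≥ 2`)
  have hRge : 2 * Real.log X ≤ Real.log X * t * r / s := by
    rw [le_div_iff₀ hs0]
    have h1 : 2 * Real.log X * s ≤ 2 * Real.log X * t :=
      mul_le_mul_of_nonneg_left (by linarith) (by positivity)
    have h2 : 2 * Real.log X * t ≤ Real.log X * t * r := by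
      have := mul_le_mul_of_nonneg_left hr2 (show 0 ≤ Real.log X * t by positivity)
      linarith
    linarith
  -- hence `U ≥ 1`
  have hαlogX : 64 ≤ α * Real.log X := by
    have := mul_le_mul_of_nonneg_left hlogXα hα.le
    rwa [mul_div_cancel₀ _ hα.ne'] at this
  have hU7 : (7 : ℝ) ≤ U := by
    have h1 : α * (Real.log X * t * r / s / 16) ≤ α * ((z : ℝ) * ℓ * ℓ₃ / ℓ₂) :=
      mul_le_mul_of_nonneg_left hRle hα.le
    have h2 : α * (2 * Real.log X) ≤ α * (Real.log X * t * r / s) :=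
      mul_le_mul_of_nonneg_left hRge hα.le
    have h3 : α * (Real.log X * t * r / s / 16) = α * (Real.log X * t * r / s) / 16 := by
      ring
    linarith
  have hU1 : 1 ≤ U := by exact_mod_cast (show (1 : ℝ) ≤ U by linarith)
  -- the gap supplied by the cover
  have hgap := hasPrimeGap_of_cover hcovX hU1
  refine hgap.mono ?_ ?_
  · -- `2 (z + P(z) + U) ≤ X`
    have hprim : ((primorial z : ℕ) : ℝ) ≤ Real.sqrt X := by
      have h4 : ((primorial z : ℕ) : ℝ) ≤ (4 : ℝ) ^ (z : ℝ) := by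
        rw [Real.rpow_natCast]; exact_mod_cast primorial_le_four_pow z
      refine h4.trans ?_
      rw [Real.sqrt_eq_rpow, Real.rpow_def_of_pos (by norm_num : (0 : ℝ) < 4),
        Real.rpow_def_of_pos hXpos, Real.exp_le_exp]
      calc Real.log 4 * (z : ℝ) ≤ 3 / 2 * (Real.log X / 3) := by gcongr
        _ = Real.log X * (1 / 2) := by ring
    have hsqrt : Real.sqrt X ≤ X / 4 := by
      have h16 : Real.sqrt 16 = 4 := by
        rw [show (16 : ℝ) = 4 ^ 2 by norm_num, Real.sqrt_sq (by norm_num)]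
      have h4 : 4 ≤ Real.sqrt X := h16 ▸ Real.sqrt_le_sqrt hX16
      have h5 := Real.mul_self_sqrt hXpos.le
      have h6 := mul_le_mul_of_nonneg_right h4 (Real.sqrt_nonneg X)
      linarith only [h5, h6]
    have hVle : (z : ℝ) * ℓ * ℓ₃ / ℓ₂ ≤ (z : ℝ) * ℓ := by
      rw [div_le_iff₀ hℓ₂0]
      exact mul_le_mul_of_nonneg_left (by linarith) (by positivity)
    have htX : t ≤ Real.log X := by
      rw [ht]; exact (Real.log_le_sub_one_of_pos hlogXpos).trans (by linarith)
    have hzℓ : (z : ℝ) * ℓ ≤ Real.log X ^ 2 :=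
      calc (z : ℝ) * ℓ ≤ Real.log X / 3 * Real.log X :=
            mul_le_mul hzle (hℓle.trans htX) hℓ0.le (by positivity)
        _ ≤ Real.log X ^ 2 := by
            rw [sq]; exact mul_le_mul_of_nonneg_right (by linarith) hlogXpos.le
    have hN : (U : ℝ) ≤ 1 / 8 * X :=
      calc (U : ℝ) ≤ α * ((z : ℝ) * ℓ * ℓ₃ / ℓ₂) := hUle
        _ ≤ α * Real.log X ^ 2 := mul_le_mul_of_nonneg_left (hVle.trans hzℓ) hα.le
        _ ≤ 1 / 8 * X := hoX
    have hzX : (z : ℝ) ≤ 1 / 24 * X := by linarith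
    linarith only [hzX, hprim, hsqrt, hN]
  · -- `(α/64) · fgkmtRate X ≤ U + 1`
    have i2 : Real.log^[2] X = t := by
      rw [ht]; simp [Function.iterate_succ_apply']
    have i3 : Real.log^[3] X = s := by
      rw [hs, ht]; simp [Function.iterate_succ_apply']
    have i4 : Real.log^[4] X = r := by
      rw [hr, hs, ht]; simp [Function.iterate_succ_apply']
    rw [fgkmtRate, i2, i3, i4]
    push_cast
    have h1 : α / 64 * (Real.log X * t * r / s) ≤ α * (Real.log X * t * r / s / 16) := by
      have h2 : α / 64 * (Real.log X * t * r / s) =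
          α * (Real.log X * t * r / s / 16) / 4 := by ring
      rw [h2, div_le_iff₀ (by norm_num : (0 : ℝ) < 4)]
      have h3 : 0 ≤ α * (Real.log X * t * r / s / 16) := by positivity
      linarith
    have h2 : α * (Real.log X * t * r / s / 16) ≤ α * ((z : ℝ) * ℓ * ℓ₃ / ℓ₂) :=
      mul_le_mul_of_nonneg_left hRle hα.le
    linarith

open Asymptotics in
/-- **The transfer at the FGKMT rate.** If for all large `w` one residue class per prime `p ≤ w`
covers `{1, …, ⌊α · w log w log₃ w/log₂ w⌋}`, then for all large `X`,
`G(X) ≥ (α/64) log X log₂ X log₄ X/log₃ X`.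
[cite: FordGreenKonyaginMaynardTao2018, Lemma 1.1 and (1.2)] -/
theorem eventually_hasPrimeGap_of_cover {α : ℝ} (hα : 0 < α)
    (hcov : ∀ᶠ w : ℕ in atTop, ResidueClassesCover w
      ⌊α * ((w : ℝ) * Real.log w * Real.log (Real.log (Real.log w)) /
        Real.log (Real.log w))⌋₊) :
    ∀ᶠ X : ℝ in atTop, HasPrimeGap X (α / 64 * fgkmtRate X) := by
  have hz : Tendsto (fun X : ℝ => ⌊Real.log X / 3⌋₊) atTop atTop :=
    tendsto_nat_floor_atTop.comp (Real.tendsto_log_atTop.atTop_div_const (by norm_num))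
  have hT₂ : Tendsto (fun X : ℝ => Real.log (Real.log X)) atTop atTop :=
    Real.tendsto_log_atTop.comp Real.tendsto_log_atTop
  have hT₄ : Tendsto (fun X : ℝ => Real.log (Real.log (Real.log (Real.log X)))) atTop atTop :=
    Real.tendsto_log_atTop.comp (Real.tendsto_log_atTop.comp hT₂)
  have hoX := (Real.isLittleO_pow_log_id_atTop (n := 2)).bound
    (show (0 : ℝ) < 1 / (8 * α) by positivity)
  have hlin := Real.isLittleO_log_id_atTop.bound (show (0 : ℝ) < 1 / 8 by norm_num)
  filter_upwards [hz.eventually hcov, hz.eventually (eventually_ge_atTop 3),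
    hoX, hlin, hT₂.eventually_ge_atTop 3, hT₄.eventually_ge_atTop 2, eventually_ge_atTop (16 : ℝ),
    eventually_ge_atTop (Real.exp 12), Real.tendsto_log_atTop.eventually_ge_atTop (64 / α)]
    with X hcovX hz3 hoX' hlinX hT3 hr2 hX16 hX12 hlogXα
  have hXpos : 0 < X := by linarith
  have hlogXpos : 0 < Real.log X := Real.log_pos (by linarith)
  rw [Real.norm_eq_abs, Real.norm_eq_abs, id, abs_of_nonneg (by positivity),
    abs_of_pos hXpos] at hoX'
  rw [Real.norm_eq_abs, Real.norm_eq_abs, id, abs_of_pos hlogXpos, abs_of_pos hXpos] at hlinX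
  have hoX'' : α * Real.log X ^ 2 ≤ 1 / 8 * X := by
    have h := mul_le_mul_of_nonneg_left hoX' hα.le
    calc α * Real.log X ^ 2 ≤ α * (1 / (8 * α) * X) := h
      _ = 1 / 8 * X := by field_simp
  exact gap_of_params hα rfl rfl rfl rfl rfl rfl rfl rfl hcovX hz3 hlogXα hoX'' hlinX hT3 hr2
    hX16 hX12

end FGKMTTransfer

/-! ### Ford–Green–Konyagin–Maynard–Tao 2018: (1.2) ⇒ Theorem 1 -/

/-- **FGKMT 2018: the covering bound (1.2) ⇒ Theorem 1** (`Y(x) ≫ x log x log₃ x/log₂ x` gives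
`G(X) ≫ log X log₂ X log₄ X/log₃ X` for all large `X`, by Lemma 1.1). PROVED (transfer at
`x = ⌊log X/3⌋`, constant `c/64`). [cite: FordGreenKonyaginMaynardTao2018, Theorem 1, Lemma 1.1 and (1.2)] -/
theorem fgkmt2018_theorem1_of_coveringBound (h : FordGreenKonyaginMaynardTao2018_coveringBound) :
    FordGreenKonyaginMaynardTao2018_theorem1 := by
  obtain ⟨c, hc, hcov⟩ := h
  refine ⟨c / 64, by positivity, FGKMTTransfer.eventually_hasPrimeGap_of_cover hc ?_⟩
  filter_upwards [hcov] with w hw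
  obtain ⟨y, hy, hcw⟩ := hw
  rw [iterate_log_three, iterate_log_two] at hy
  exact hcw.mono le_rfl ((Nat.floor_le_floor hy).trans (Nat.floor_natCast y).le)

/-- **FGKMT (1.2) ⇒ every Rankin constant** (through Theorem 1 and `rankinConstant_of_fgkmt`).
[cite: FordGreenKonyaginMaynardTao2018, Theorem 1 and (1.2)] -/
theorem rankinConstant_of_fgkmt2018_coveringBound
    (h : FordGreenKonyaginMaynardTao2018_coveringBound) (c : ℝ) : RankinConstant c :=
  rankinConstant_of_fgkmt (fgkmt2018_theorem1_of_coveringBound h) c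

end Literature.NumberTheory.Sieve
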